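import Summits.Langlands.Langlands.Theorems.WeilRestrictionSplitWeilRestrictionConstituentDevissage
import HarnessLib

/-!
# Frobenius reciprocity for constituents, in frames: an irreducible subquotient of `Ind θ` containing `θ`
(support item stmt-Langlands-31696 `WeilRestrictionSplit.WeilRestrictionConstituent`, helper file 3)

Pure (topological) linear algebra, no arithmetic.  Let `I : G →ₜ* GL_N(k)` be a framed
representation of a topological group `G` over a topological field `k`, `res : H →* G` a
homomorphism, `θ : H →* GL_m(k)` (`m ≥ 1`) IRREDUCIBLE (no proper non-zero subspace of `kᵐ` stable
under all `θ(σ)`), and `f : kᵐ → kᴺ` an injective linear map with `I(res σ)·f(x) = f(θ(σ)·x)` — i.e.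
`θ ↪ I|_H` (for us: `I = Ind θ` and `f` = the trivial-coset block, the unit of Frobenius
reciprocity).  Then (`exists_irreducible_subquotient`) there is an IRREDUCIBLE subquotient `R` of
`I` — presented in frames: `P₁ I P₁⁻¹ = (X *; 0 Z)`, `P₂ X P₂⁻¹ = (Y *; 0 R)` with continuous
diagonal blocks — together with an injective linear `f₂ : kᵐ → kᵇ` with
`R(res σ)·f₂(x) = f₂(θ(σ)·x)`, i.e. `θ ↪ R|_H`.  Proof (Jordan–Hölder bookkeeping, finite
dimension only): `U` := a stable subspace of `kᴺ` containing `f(kᵐ)` of minimal dimension, `U'` := a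
stable subspace properly contained in `U` of maximal dimension; then `R = U/U'` is irreducible, and
`f(kᵐ) ∩ U' = 0` because `f⁻¹(U')` is `θ`-stable and `f(kᵐ) ⊄ U'` (minimality of `U`), so
`θ ↪ U/U'`.  The frames and comparison maps come from the recorded dévissage
(`exists_conj_blockTriangular_recorded`).  Finally (`exists_corner_trace_eq`), if `θ ↪ ψ` for a
framed `ψ : H →ₜ* GL_b(k)` then `Q ψ Q⁻¹ = (C *; 0 C')` with `tr C(σ) = tr θ(σ)` (dévissage of `ψ`
along the image; the corner is conjugate to `θ` by the linear isomorphism `kᵐ ≅ image`,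
`LinearMap.trace_conj'`).

References: J.-P. Serre, *Linear representations of finite groups* (1977), §7.2 (Frobenius
reciprocity), §3.3; C. W. Curtis, I. Reiner, *Methods of Representation Theory* I (1981), §10A, §16B.
-/

noncomputable section

set_option linter.dupNamespace false -- project-wide option (lakefile weak.linter.dupNamespace); `Summit.Langlands.Langlands` is the mandated namespace

open scoped MatrixGroups
open Matrix Module
open Literature.NumberTheory.GaloisRepresentations
open Summit.Langlands.Langlands.Theorems.ReciprocityUpToIrreducibility

namespace Summit.Langlands.Langlands.Theorems.WeilRestrictionConstituentProof

universe u v w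

variable {k : Type u} [Field k] [TopologicalSpace k] [IsTopologicalRing k]
  {G : Type v} [Group G] [TopologicalSpace G] {H : Type w} [Group H]

/-- **An irreducible subquotient of `I` into which `θ` still embeds** (Frobenius reciprocity for
constituents, Jordan–Hölder form).  See the module docstring: `U` minimal stable containing
`f(kᵐ)`, `U'` maximal stable properly inside `U`, `R = U/U'` in frames
(`P₁ I P₁⁻¹ = (X *; 0 Z)`, `X ≅ U`; `P₂ X P₂⁻¹ = (Y *; 0 R)`, `Y ≅ U'`, `R ≅ U/U'`), `R` irreducible of
positive rank, and `f₂ = β ∘ α⁻¹ ∘ f : kᵐ ↪ kᵇ` intertwining `θ` with `R ∘ res`.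
[cite: SerreLinearRepresentations1977, §7.2] -/
theorem exists_irreducible_subquotient {N m : ℕ} (I : FramedRep G k N) (res : H →* G)
    (θ : H →* GL (Fin m) k) (hm : 0 < m)
    (hθ : ∀ S : Submodule k (Fin m → k),
      (∀ σ x, x ∈ S → ((θ σ : GL (Fin m) k) : Matrix (Fin m) (Fin m) k) *ᵥ x ∈ S) →
        S = ⊥ ∨ S = ⊤)
    (f : (Fin m → k) →ₗ[k] (Fin N → k)) (hf : Function.Injective f)
    (hfeq : ∀ σ x, ((I (res σ) : GL (Fin N) k) : Matrix (Fin N) (Fin N) k) *ᵥ f x =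
      f (((θ σ : GL (Fin m) k) : Matrix (Fin m) (Fin m) k) *ᵥ x)) :
    ∃ (a pa : ℕ) (ea : Fin a ⊕ Fin pa ≃ Fin N) (P₁ : GL (Fin N) k) (X : FramedRep G k a)
      (Z : FramedRep G k pa) (ba b : ℕ) (eb : Fin ba ⊕ Fin b ≃ Fin a) (P₂ : GL (Fin a) k)
      (Y : FramedRep G k ba) (R : FramedRep G k b) (f₂ : (Fin m → k) →ₗ[k] (Fin b → k)),
      (∀ g, ∃ B : Matrix (Fin a) (Fin pa) k,
        ((FramedRep.conj P₁ I g : GL (Fin N) k) : Matrix (Fin N) (Fin N) k) =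
          Matrix.reindex ea ea (Matrix.fromBlocks
            ((X g : GL (Fin a) k) : Matrix (Fin a) (Fin a) k) B 0
            ((Z g : GL (Fin pa) k) : Matrix (Fin pa) (Fin pa) k))) ∧
      (∀ g, ∃ B : Matrix (Fin ba) (Fin b) k,
        ((FramedRep.conj P₂ X g : GL (Fin a) k) : Matrix (Fin a) (Fin a) k) =
          Matrix.reindex eb eb (Matrix.fromBlocks
            ((Y g : GL (Fin ba) k) : Matrix (Fin ba) (Fin ba) k) B 0
            ((R g : GL (Fin b) k) : Matrix (Fin b) (Fin b) k))) ∧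
      0 < b ∧ (FramedRep.toRepresentation R).IsIrreducible ∧ Function.Injective f₂ ∧
      ∀ σ x, ((R (res σ) : GL (Fin b) k) : Matrix (Fin b) (Fin b) k) *ᵥ f₂ x =
        f₂ (((θ σ : GL (Fin m) k) : Matrix (Fin m) (Fin m) k) *ᵥ x) := by
  classical
  -- the representation of `G` on `kᴺ` through `I`
  let RI : Representation k G (Fin N → k) := FramedRep.toRepresentation I
  -- (1) a stable subspace `U ⊇ f(kᵐ)` of minimal dimension
  have hex : ∃ r, ∃ U : Subrepresentation RI, LinearMap.range f ≤ U.toSubmodule ∧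
      Module.finrank k U.toSubmodule = r :=
    ⟨_, ⊤, fun x _ ↦ show x ∈ (⊤ : Submodule k (Fin N → k)) from Submodule.mem_top, rfl⟩
  obtain ⟨U, hfU, hUr⟩ := Nat.find_spec hex
  have hUmin : ∀ U₁ : Subrepresentation RI, LinearMap.range f ≤ U₁.toSubmodule →
      U₁.toSubmodule ≤ U.toSubmodule → U₁.toSubmodule = U.toSubmodule := by
    intro U₁ hfU₁ hle
    by_contra hne
    have h1 := Submodule.finrank_lt_finrank_of_lt (lt_of_le_of_ne hle hne)
    have h2 := Nat.find_min' hex ⟨U₁, hfU₁, rfl⟩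
    rw [hUr] at h1
    omega
  -- (2) a stable subspace `U' ⊊ U` of maximal dimension
  have hfne : LinearMap.range f ≠ ⊥ := by
    intro h
    rw [LinearMap.range_eq_bot] at h
    have h1 : (Pi.single (⟨0, hm⟩ : Fin m) (1 : k) : Fin m → k) = 0 :=
      hf (by rw [h, LinearMap.zero_apply, map_zero])
    have h2 := congrFun h1 ⟨0, hm⟩
    simp at h2
  have hUne : U.toSubmodule ≠ ⊥ := fun h ↦ hfne (le_bot_iff.1 (hfU.trans h.le))
  have hbotU : (⊥ : Subrepresentation RI).toSubmodule < U.toSubmodule :=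
    bot_lt_iff_ne_bot.2 hUne
  have hex' : ∃ s, ∃ U' : Subrepresentation RI, U'.toSubmodule < U.toSubmodule ∧
      Module.finrank k U'.toSubmodule + s = Module.finrank k U.toSubmodule :=
    ⟨_, ⊥, hbotU, Nat.add_sub_of_le (Submodule.finrank_mono hbotU.le)⟩
  obtain ⟨U', hU'lt, hU's⟩ := Nat.find_spec hex'
  have hU'max : ∀ U₂ : Subrepresentation RI, U'.toSubmodule ≤ U₂.toSubmodule →
      U₂.toSubmodule < U.toSubmodule → U₂.toSubmodule = U'.toSubmodule := by
    intro U₂ hle hlt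
    by_contra hne
    have h1 := Submodule.finrank_lt_finrank_of_lt (lt_of_le_of_ne hle (Ne.symm hne))
    have h2 := Submodule.finrank_lt_finrank_of_lt hlt
    have h3 := Nat.find_min' hex' ⟨U₂, hlt, Nat.add_sub_of_le h2.le⟩
    omega
  -- (3) `f(kᵐ) ⊄ U'`, hence `f⁻¹(U') = 0` by irreducibility of `θ`
  have hfU' : ¬ LinearMap.range f ≤ U'.toSubmodule := fun h ↦
    (ne_of_lt hU'lt) (hUmin U' h hU'lt.le)
  have hcomap : ∀ x, f x ∈ U'.toSubmodule → x = 0 := by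
    rcases hθ (U'.toSubmodule.comap f) (fun σ x hx ↦ by
        change f _ ∈ U'.toSubmodule
        rw [← hfeq]
        exact U'.apply_mem_toSubmodule (res σ) hx) with h | h
    · intro x hx
      have hx' : x ∈ U'.toSubmodule.comap f := hx
      rw [h] at hx'
      exact (Submodule.mem_bot k).1 hx'
    · exact absurd (LinearMap.range_le_iff_comap.2 h) hfU'
  -- (4) dévissage of `I` along `U`: `P₁ I P₁⁻¹ = (X *; 0 Z)`, `α₁ : kᵃ ≅ U`
  obtain ⟨a, pa, -, ea, P₁, X, BX, Z, -, hconj₁, ⟨α₁, hα₁, hα₁r, hα₁eq⟩, -⟩ :=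
    exists_conj_blockTriangular_recorded I.toMonoidHom U
  have hα₁eq' : ∀ g y, ((I g : GL (Fin N) k) : Matrix (Fin N) (Fin N) k) *ᵥ α₁ y =
      α₁ (X g *ᵥ y) := fun g y ↦ hα₁eq g y
  have hconj₁' : ∀ g, ((FramedRep.conj P₁ I g : GL (Fin N) k) : Matrix (Fin N) (Fin N) k) =
      Matrix.reindex ea ea (Matrix.fromBlocks (X g) (BX g) 0 (Z g)) := fun g ↦ hconj₁ g
  obtain ⟨Xc, Zc, hXZ⟩ :=
    exists_continuousHom_blocks_of_blockTriangular (k := k) ea (FramedRep.conj P₁ I) X BX Z hconj₁'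
  have hT₁ : ∀ g, ∃ B : Matrix (Fin a) (Fin pa) k,
      ((FramedRep.conj P₁ I g : GL (Fin N) k) : Matrix (Fin N) (Fin N) k) =
        Matrix.reindex ea ea (Matrix.fromBlocks
          ((Xc g : GL (Fin a) k) : Matrix (Fin a) (Fin a) k) B 0
          ((Zc g : GL (Fin pa) k) : Matrix (Fin pa) (Fin pa) k)) := fun g ↦
    ⟨BX g, by rw [(hXZ g).1, (hXZ g).2]; exact hconj₁' g⟩
  -- (5) dévissage of `X` along `U'' = α₁⁻¹(U')`: `P₂ X P₂⁻¹ = (Y *; 0 R)`, `β₂ : kᵃ/U'' ≅ kᵇ`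
  let U'' : Subrepresentation
      ((Representation.ofDistribMulAction k (GL (Fin a) k) (Fin a → k)).comp Xc.toMonoidHom) :=
    ⟨U'.toSubmodule.comap α₁, fun g x hx ↦ by
      change α₁ (((Xc g : GL (Fin a) k) : Matrix (Fin a) (Fin a) k) *ᵥ x) ∈ U'.toSubmodule
      rw [(hXZ g).1, ← hα₁eq']
      exact U'.apply_mem_toSubmodule g hx⟩
  obtain ⟨ba, b, hbab, eb, P₂, Y, BY, Rm, hfinU'', hconj₂, -, ⟨β₂, hβ₂, hβ₂k, hβ₂eq⟩⟩ :=
    exists_conj_blockTriangular_recorded Xc.toMonoidHom U''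
  have hβ₂eq' : ∀ g y, β₂ (X g *ᵥ y) = Rm g *ᵥ β₂ y := fun g y ↦ by
    rw [← (hXZ g).1]
    exact hβ₂eq g y
  have hβ₂k' : LinearMap.ker β₂ = U'.toSubmodule.comap α₁ := hβ₂k
  have hconj₂' : ∀ g, ((FramedRep.conj P₂ Xc g : GL (Fin a) k) : Matrix (Fin a) (Fin a) k) =
      Matrix.reindex eb eb (Matrix.fromBlocks (Y g) (BY g) 0 (Rm g)) := fun g ↦ hconj₂ g
  obtain ⟨Yc, Rc, hYR⟩ :=
    exists_continuousHom_blocks_of_blockTriangular (k := k) eb (FramedRep.conj P₂ Xc) Y BY Rm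
      hconj₂'
  have hT₂ : ∀ g, ∃ B : Matrix (Fin ba) (Fin b) k,
      ((FramedRep.conj P₂ Xc g : GL (Fin a) k) : Matrix (Fin a) (Fin a) k) =
        Matrix.reindex eb eb (Matrix.fromBlocks
          ((Yc g : GL (Fin ba) k) : Matrix (Fin ba) (Fin ba) k) B 0
          ((Rc g : GL (Fin b) k) : Matrix (Fin b) (Fin b) k)) := fun g ↦
    ⟨BY g, by rw [(hYR g).1, (hYR g).2]; exact hconj₂' g⟩
  -- (6) `0 < b`: `U'' ≠ kᵃ` since `f(kᵐ) ⊄ U'`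
  have hfα : LinearMap.range f ≤ LinearMap.range α₁ := by rw [hα₁r]; exact hfU
  have hU''ne : U'.toSubmodule.comap α₁ ≠ ⊤ := by
    intro h
    apply hfU'
    intro y hy
    obtain ⟨x, rfl⟩ : y ∈ LinearMap.range α₁ := hfα hy
    have hx : x ∈ U'.toSubmodule.comap α₁ := by rw [h]; exact Submodule.mem_top
    exact hx
  have hb : 0 < b := by
    have h1 : Module.finrank k (U'.toSubmodule.comap α₁) < Module.finrank k (Fin a → k) :=
      Submodule.finrank_lt hU''ne
    rw [Module.finrank_fin_fun] at h1
    change Module.finrank k (U'.toSubmodule.comap α₁) = ba at hfinU''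
    omega
  -- (7) the intertwining map `f₂ = β₂ ∘ α₁⁻¹ ∘ f`
  let g₁ : (Fin m → k) →ₗ[k] (Fin a → k) :=
    (LinearEquiv.ofInjective α₁ hα₁).symm.toLinearMap ∘ₗ
      f.codRestrict (LinearMap.range α₁) (fun x ↦ hfα (LinearMap.mem_range_self f x))
  have hg₁ : ∀ x, α₁ (g₁ x) = f x := fun x ↦ by
    simp only [g₁, LinearMap.coe_comp, LinearEquiv.coe_coe, Function.comp_apply]
    rw [LinearEquiv.ofInjective_symm_apply]
    rfl
  have hg₁eq : ∀ σ x, g₁ (((θ σ : GL (Fin m) k) : Matrix (Fin m) (Fin m) k) *ᵥ x) =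
      X (res σ) *ᵥ g₁ x := fun σ x ↦
    hα₁ (by rw [hg₁, ← hα₁eq', hg₁, hfeq])
  let f₂ : (Fin m → k) →ₗ[k] (Fin b → k) := β₂ ∘ₗ g₁
  have hf₂eq : ∀ σ x, ((Rc (res σ) : GL (Fin b) k) : Matrix (Fin b) (Fin b) k) *ᵥ f₂ x =
      f₂ (((θ σ : GL (Fin m) k) : Matrix (Fin m) (Fin m) k) *ᵥ x) := by
    intro σ x
    change _ = β₂ (g₁ _)
    rw [hg₁eq, hβ₂eq', (hYR (res σ)).2]
    rfl
  have hf₂ : Function.Injective f₂ := by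
    refine (injective_iff_map_eq_zero f₂).2 fun x hx ↦ hcomap x ?_
    have h1 : g₁ x ∈ LinearMap.ker β₂ := hx
    rw [hβ₂k'] at h1
    have h2 : α₁ (g₁ x) ∈ U'.toSubmodule := h1
    rwa [hg₁] at h2
  -- (8) irreducibility of `R`
  have hirrR : (FramedRep.toRepresentation Rc).IsIrreducible := by
    haveI : Nontrivial (Subrepresentation (FramedRep.toRepresentation Rc)) :=
      ⟨⟨⊥, ⊤, fun h ↦ by
        have h' := congrArg Subrepresentation.toSubmodule h
        change (⊥ : Submodule k (Fin b → k)) = ⊤ at h'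
        haveI : Nonempty (Fin b) := ⟨⟨0, hb⟩⟩
        exact bot_ne_top h'⟩⟩
    refine ⟨fun S ↦ ?_⟩
    -- `T = α₁ (β₂⁻¹ S)`, a stable subspace with `U' ≤ T ≤ U`
    let T : Submodule k (Fin N → k) := (S.toSubmodule.comap β₂).map α₁
    have hTstab : ∀ g v, v ∈ T →
        ((I g : GL (Fin N) k) : Matrix (Fin N) (Fin N) k) *ᵥ v ∈ T := by
      rintro g _ ⟨y, hy, rfl⟩
      refine ⟨X g *ᵥ y, ?_, (hα₁eq' g y).symm⟩
      change β₂ (X g *ᵥ y) ∈ S.toSubmodule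
      rw [hβ₂eq', ← (hYR g).2]
      exact S.apply_mem_toSubmodule g hy
    let T' : Subrepresentation RI := ⟨T, fun g v hv ↦ hTstab g v hv⟩
    have hU'T : U'.toSubmodule ≤ T := by
      intro u hu
      have huU : u ∈ LinearMap.range α₁ := by rw [hα₁r]; exact hU'lt.le hu
      obtain ⟨y, rfl⟩ := huU
      refine ⟨y, ?_, rfl⟩
      change β₂ y ∈ S.toSubmodule
      have hy : y ∈ LinearMap.ker β₂ := by rw [hβ₂k']; exact hu
      rw [LinearMap.mem_ker] at hy
      rw [hy]
      exact S.toSubmodule.zero_mem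
    have hTU : T ≤ U.toSubmodule := by rw [← hα₁r]; exact LinearMap.map_le_range
    rcases eq_or_ne T U.toSubmodule with hTeq | hTne
    · -- `T = U`: `S = ⊤`
      right
      apply Subrepresentation.toSubmodule_injective
      change S.toSubmodule = ⊤
      refine eq_top_iff.2 fun z _ ↦ ?_
      obtain ⟨y, rfl⟩ := hβ₂ z
      have hy : α₁ y ∈ T := by rw [hTeq, ← hα₁r]; exact LinearMap.mem_range_self α₁ y
      obtain ⟨y', hy', hyy'⟩ := hy
      rw [← hα₁ hyy']
      exact hy'
    · -- `T = U'`: `S = ⊥`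
      left
      have hTeq : T = U'.toSubmodule := hU'max T' hU'T (lt_of_le_of_ne hTU hTne)
      apply Subrepresentation.toSubmodule_injective
      change S.toSubmodule = ⊥
      refine (Submodule.eq_bot_iff _).2 fun z hz ↦ ?_
      obtain ⟨y, rfl⟩ := hβ₂ z
      have hyT : α₁ y ∈ T := ⟨y, hz, rfl⟩
      rw [hTeq] at hyT
      have hy : y ∈ LinearMap.ker β₂ := by rw [hβ₂k']; exact hyT
      exact LinearMap.mem_ker.1 hy
  exact ⟨a, pa, ea, P₁, Xc, Zc, ba, b, eb, P₂, Yc, Rc, f₂, hT₁, hT₂, hb, hirrR, hf₂, hf₂eq⟩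

variable [TopologicalSpace H]

/-- **The corner of `ψ` along the image of `θ` has the character of `θ`.**  If a framed
`ψ : H →ₜ* GL_b(k)` receives an injective linear `f₂ : kᵐ → kᵇ` intertwining `θ : H →* GL_m(k)`
with `ψ`, then in a frame adapted to the stable subspace `f₂(kᵐ)` one has `Q ψ Q⁻¹ = (C *; 0 C')`
with continuous diagonal blocks and `tr C(σ) = tr θ(σ)` for all `σ` (the corner is conjugate to
`θ` by the linear isomorphism `kᵐ ≅ f₂(kᵐ) ≅ kᶜ`; Mathlib `LinearMap.trace_conj'`).
[cite: SerreLinearRepresentations1977, §7.2] -/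
theorem exists_corner_trace_eq {b m : ℕ} (ψ : FramedRep H k b) (θ : H →* GL (Fin m) k)
    (f₂ : (Fin m → k) →ₗ[k] (Fin b → k)) (hf₂ : Function.Injective f₂)
    (heq : ∀ σ x, ((ψ σ : GL (Fin b) k) : Matrix (Fin b) (Fin b) k) *ᵥ f₂ x =
      f₂ (((θ σ : GL (Fin m) k) : Matrix (Fin m) (Fin m) k) *ᵥ x)) :
    ∃ (c pc : ℕ) (ec : Fin c ⊕ Fin pc ≃ Fin b) (Q : GL (Fin b) k) (C : FramedRep H k c)
      (C' : FramedRep H k pc),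
      (∀ σ, ∃ B : Matrix (Fin c) (Fin pc) k,
        ((FramedRep.conj Q ψ σ : GL (Fin b) k) : Matrix (Fin b) (Fin b) k) =
          Matrix.reindex ec ec (Matrix.fromBlocks
            ((C σ : GL (Fin c) k) : Matrix (Fin c) (Fin c) k) B 0
            ((C' σ : GL (Fin pc) k) : Matrix (Fin pc) (Fin pc) k))) ∧
      ∀ σ, FramedRep.trace C σ = (((θ σ : GL (Fin m) k) : Matrix (Fin m) (Fin m) k)).trace := by
  classical
  -- the stable subspace `f₂(kᵐ)`
  let W₁ : Subrepresentation
      ((Representation.ofDistribMulAction k (GL (Fin b) k) (Fin b → k)).comp ψ.toMonoidHom) :=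
    ⟨LinearMap.range f₂, by
      rintro σ _ ⟨x, rfl⟩
      exact ⟨_, (heq σ x).symm⟩⟩
  obtain ⟨c, pc, -, ec, Q, C, B₃, C', -, hconj, ⟨α₃, hα₃, hα₃r, hα₃eq⟩, -⟩ :=
    exists_conj_blockTriangular_recorded ψ.toMonoidHom W₁
  have hα₃eq' : ∀ σ y, ((ψ σ : GL (Fin b) k) : Matrix (Fin b) (Fin b) k) *ᵥ α₃ y =
      α₃ (C σ *ᵥ y) := fun σ y ↦ hα₃eq σ y
  have hα₃r' : LinearMap.range α₃ = LinearMap.range f₂ := hα₃r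
  have hconj' : ∀ σ, ((FramedRep.conj Q ψ σ : GL (Fin b) k) : Matrix (Fin b) (Fin b) k) =
      Matrix.reindex ec ec (Matrix.fromBlocks (C σ) (B₃ σ) 0 (C' σ)) := fun σ ↦ hconj σ
  obtain ⟨Cc, C'c, hCC⟩ :=
    exists_continuousHom_blocks_of_blockTriangular (k := k) ec (FramedRep.conj Q ψ) C B₃ C' hconj'
  refine ⟨c, pc, ec, Q, Cc, C'c, fun σ ↦ ⟨B₃ σ, by rw [(hCC σ).1, (hCC σ).2]; exact hconj' σ⟩,
    fun σ ↦ ?_⟩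
  -- `γ : kᵐ ≅ kᶜ` with `α₃ ∘ γ = f₂`
  let γ : (Fin m → k) ≃ₗ[k] (Fin c → k) :=
    (LinearEquiv.ofInjective f₂ hf₂).trans
      ((LinearEquiv.ofEq _ _ hα₃r'.symm).trans (LinearEquiv.ofInjective α₃ hα₃).symm)
  have hγ : ∀ x, α₃ (γ x) = f₂ x := fun x ↦ by
    simp only [γ, LinearEquiv.trans_apply]
    rw [LinearEquiv.ofInjective_symm_apply]
    rfl
  have hγeq : ∀ x, γ (((θ σ : GL (Fin m) k) : Matrix (Fin m) (Fin m) k) *ᵥ x) =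
      C σ *ᵥ γ x := fun x ↦
    hα₃ (by rw [hγ, ← heq, ← hγ, hα₃eq'])
  have hlin : Matrix.toLin' (C σ) =
      γ.conj (Matrix.toLin' ((θ σ : GL (Fin m) k) : Matrix (Fin m) (Fin m) k)) := by
    apply LinearMap.ext
    intro z
    rw [LinearEquiv.conj_apply]
    simp only [LinearMap.comp_apply, LinearEquiv.coe_coe, Matrix.toLin'_apply]
    rw [hγeq, LinearEquiv.apply_symm_apply]
  calc FramedRep.trace Cc σ = (C σ).trace := by rw [FramedRep.trace, (hCC σ).1]
    _ = LinearMap.trace k _ (Matrix.toLin' (C σ)) := (Matrix.trace_toLin'_eq _).symm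
    _ = (((θ σ : GL (Fin m) k) : Matrix (Fin m) (Fin m) k)).trace := by
      rw [hlin, LinearMap.trace_conj', Matrix.trace_toLin'_eq]

end Summit.Langlands.Langlands.Theorems.WeilRestrictionConstituentProof

end
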